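import Mathlib.Analysis.SpecialFunctions.Complex.Analytic
import Mathlib.Analysis.Analytic.IsolatedZeros
import HarnessLib

/-!
# The form `t^μ e^{ℓ(t)}` of a meromorphic coordinate that does not vanish near `0`

Topic `Literature/Analysis/Complex` (namespace `Literature.Analysis.Complex.BranchOrders`).
For `Φ` analytic at `0` which is not identically zero near `0` and `N ∈ ℕ`, the meromorphic germ
`Φ(t)/t^N` is `t^μ · e^{ℓ(t)}` on a punctured neighbourhood of `0`, with `μ ∈ ℤ` (its order) and
`ℓ` an analytic branch of the logarithm of the unit part (`exists_zpow_exp_form`); the unit part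
itself is recorded in `exists_pow_mul_unit_form`. These are the local logarithms `ℓⱼ = log yⱼ`
and orders `μⱼ = ord yⱼ` of the multiplicative coordinates of a branch of an algebraic curve at
a place at infinity. PROVED, no definition. [folklore]
-/

noncomputable section

open Complex Filter Topology Set Metric

namespace Literature.Analysis.Complex

namespace BranchOrders

/-- A germ frequently non-zero on punctured neighbourhoods is not identically zero near `0`.
[folklore] -/
theorem not_eventually_eq_zero_of_frequently {Φ : ℂ → ℂ} (h : ∃ᶠ t in 𝓝[≠] (0 : ℂ), Φ t ≠ 0) :
    ¬ ∀ᶠ t in 𝓝 (0 : ℂ), Φ t = 0 := fun h0 =>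
  (h.and_eventually (eventually_nhdsWithin_of_eventually_nhds h0)).exists.elim
    fun _ ht => ht.1 ht.2

/-- **Unit form.** `Φ = t^n · U` near `0` with `U` analytic and non-vanishing near `0`, for `Φ`
analytic at `0` and not identically zero near `0`. [folklore] -/
theorem exists_pow_mul_unit_form {Φ : ℂ → ℂ} (hΦ : AnalyticAt ℂ Φ 0)
    (hne : ∃ᶠ t in 𝓝[≠] (0 : ℂ), Φ t ≠ 0) :
    ∃ (n : ℕ) (U : ℂ → ℂ), AnalyticAt ℂ U 0 ∧ U 0 ≠ 0 ∧ (∀ᶠ t in 𝓝 (0 : ℂ), U t ≠ 0) ∧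
      ∀ᶠ t in 𝓝 (0 : ℂ), Φ t = t ^ n * U t := by
  obtain ⟨n, U, hU, hU0, hΦU⟩ := (hΦ.exists_eventuallyEq_pow_smul_nonzero_iff).2
    (not_eventually_eq_zero_of_frequently hne)
  refine ⟨n, U, hU, hU0, hU.continuousAt.eventually_ne hU0, ?_⟩
  filter_upwards [hΦU] with t ht
  rw [ht, sub_zero, smul_eq_mul]

/-- **An analytic logarithm of a unit germ.** For `U` analytic at `0` with `U 0 ≠ 0` there is
`ℓ` analytic at `0` with `e^{ℓ} = U` near `0`. [folklore] -/
theorem exists_analytic_log {U : ℂ → ℂ} (hU : AnalyticAt ℂ U 0) (hU0 : U 0 ≠ 0) :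
    ∃ ℓ : ℂ → ℂ, AnalyticAt ℂ ℓ 0 ∧ ∀ᶠ t in 𝓝 (0 : ℂ), exp (ℓ t) = U t := by
  set ℓ : ℂ → ℂ := fun t => log (U t * (U 0)⁻¹) + log (U 0) with hℓ
  have hq : AnalyticAt ℂ (fun t => U t * (U 0)⁻¹) 0 := hU.mul analyticAt_const
  have hq1 : U 0 * (U 0)⁻¹ = 1 := mul_inv_cancel₀ hU0
  have hlog : AnalyticAt ℂ (fun t => log (U t * (U 0)⁻¹)) 0 :=
    hq.clog (by rw [hq1]; exact one_mem_slitPlane)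
  refine ⟨ℓ, hlog.add analyticAt_const, ?_⟩
  filter_upwards [hU.continuousAt.eventually_ne hU0] with t ht
  have hne : U t * (U 0)⁻¹ ≠ 0 := mul_ne_zero ht (inv_ne_zero hU0)
  simp only [hℓ]
  rw [Complex.exp_add, Complex.exp_log hne, Complex.exp_log hU0, mul_assoc,
    inv_mul_cancel₀ hU0, mul_one]

/-- **The form `t^μ e^{ℓ(t)}`.** For `Φ` analytic at `0`, not identically zero near `0`, and
`N ∈ ℕ`: `Φ(t)/t^N = t^μ · e^{ℓ(t)}` on a punctured neighbourhood of `0`, with `μ ∈ ℤ` and `ℓ`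
analytic at `0`; moreover the unit part `U = e^{ℓ}` with `Φ = t^{n} U`, `μ = n - N`, is
recorded. [folklore] -/
theorem exists_zpow_exp_form {Φ : ℂ → ℂ} (hΦ : AnalyticAt ℂ Φ 0)
    (hne : ∃ᶠ t in 𝓝[≠] (0 : ℂ), Φ t ≠ 0) (N : ℕ) :
    ∃ (μ : ℤ) (n : ℕ) (U ℓ : ℂ → ℂ), AnalyticAt ℂ U 0 ∧ U 0 ≠ 0 ∧ AnalyticAt ℂ ℓ 0 ∧
      μ = (n : ℤ) - N ∧ (∀ᶠ t in 𝓝 (0 : ℂ), Φ t = t ^ n * U t) ∧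
      (∀ᶠ t in 𝓝 (0 : ℂ), exp (ℓ t) = U t) ∧
      ∀ᶠ t in 𝓝[≠] (0 : ℂ), Φ t / t ^ N = t ^ μ * exp (ℓ t) := by
  obtain ⟨n, U, hU, hU0, -, hΦU⟩ := exists_pow_mul_unit_form hΦ hne
  obtain ⟨ℓ, hℓ, hexp⟩ := exists_analytic_log hU hU0
  refine ⟨(n : ℤ) - N, n, U, ℓ, hU, hU0, hℓ, rfl, hΦU, hexp, ?_⟩
  have h1 : ∀ᶠ t in 𝓝[≠] (0 : ℂ), Φ t = t ^ n * U t := eventually_nhdsWithin_of_eventually_nhds hΦU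
  have h2 : ∀ᶠ t in 𝓝[≠] (0 : ℂ), exp (ℓ t) = U t := eventually_nhdsWithin_of_eventually_nhds hexp
  filter_upwards [h1, h2, self_mem_nhdsWithin] with t ht1 ht2 ht0
  rw [Set.mem_compl_iff, Set.mem_singleton_iff] at ht0
  rw [ht1, ht2, zpow_sub₀ ht0, zpow_natCast, zpow_natCast]
  field_simp

end BranchOrders

end Literature.Analysis.Complex

end
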